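import Summits.BirchSwinnertonDyer.BirchSwinnertonDyer.Theorems.ManinLocalTwoThreePinningKernelRows
import Literature.NumberTheory.EllipticCurves.ModularCurveEtaQuotientsProofs
import Literature.NumberTheory.EllipticCurves.NewformGaloisRepIntegralityProofs
import Literature.NumberTheory.EllipticCurves.ModularCurveSturmProofs
import HarnessLib

/-!
# THE PINNING KERNEL, part G: pinning in the CUSP space `S₂(Γ₀(N))`, read in `M₂(Γ₀(N))`

Cell `bsd-f2-manin`, route `ManinLocalTwoThree`, cruxes C2 `ManinOddAtFour` (stmt-BirchSwinnertonDyer-22967) and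
C3 `ManinPrimeToThreeAtNine` (stmt-22968); planner seat -an gen 56 (`--supports` helper, turnkey T-an-g56-PKG).
Level-generic; nothing here proves C2, C3, Manin's conjecture or BSD.

Parts A–F pin the newform of an `X₀(N)`-datum inside `M₂(Γ₀(N))`, spanned by HOLOMORPHIC `η`-quotients (`dim M₂ =
g + ν_∞ − 1`).  At levels with many cusps (`N = 180`: `ν_∞ = 24`, `dim M₂ = 48`, `g = 25`) the Eisenstein part doubles the
basis and — worse — raises the rank of the coprime-to-`6` columns, so that the first decisive column relation of the staged
sieve needs four primes (`19305` extended assignments in one stage at `N = 180`).  This part runs the SAME kernel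
(`exists_smul_eq_sum_of_certs`, generic over the space `V` and the coefficient functionals) in `V = S₂(Γ₀(N))`
(`dim = g`, the tree's `finrank_cuspForm_two_eq_genusX0_holds`), on a basis of CUSPIDAL `η`-quotients (strict Ligozat
positivity, the tree's `etaQuotientCuspForm`), with the coefficient functionals `cuspCoeffₗ` of
`Literature…NewformGaloisRepIntegralityProofs` and `F = D.f` itself (`D.isNewformOf.2`), and reads the result back in
`M₂(Γ₀(N))` through the linear inclusion `S₂ → M₂` (Mathlib `CuspForm.toModularFormₗ` = `ModularFormClass.modularForm`), so that the
Fricke sieve of part C and the row/uniqueness lemmas of part F apply verbatim to the `M₂`-images of the basis: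

* §G1 `exists_etaCuspForms`: a decidably certified list of cuspidal `η`-quotients IS a family in `S₂(Γ₀(N))`;
* §G2 `smul_modularForm_eq_sum`: the inclusion `S₂ → M₂` is linear (Mathlib) and commutes with the coefficient functionals
  (part F's `modCoefₗ_modularForm`, `rfl`), so a pinning identity in `S₂` is one in `M₂`;
* §G3 `exists_smul_eq_sum_of_certs_cusp`: PINNING, LIST FORM, in `S₂` AND read in `M₂` — same certificates as part B
  (tables of the `M₂`-images, duals, staged relations, cover, coordinates) plus `dim S₂(Γ₀(N)) = g`.
[cite: CremonaAlgorithms1997, §2.10] [cite: DiamondShurman2005, Thm. 3.5.1] [cite: Ligozat1975, Ch. 3] [cite: Koehler2011, §2.1]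
-/

set_option autoImplicit false
-- lint-debt: the directory name repeats the summit name (sibling precedent `ManinLocalTwoThreePinningKernel.lean`)
set_option linter.dupNamespace false

noncomputable section

open Complex
open UpperHalfPlane hiding I
open scoped MatrixGroups ModularForm
open ModularForm CongruenceSubgroup
open Literature.NumberTheory.ModularForms
open Literature.NumberTheory.EllipticCurves Literature.NumberTheory.EllipticCurves.ModularForms

namespace Summit.BirchSwinnertonDyer.BirchSwinnertonDyer.Theorems.ManinLocalTwoThree.PinningKernel

/-! ## §G1 Certified cuspidal `η`-quotients -/

section CuspBasis

variable (N : ℕ) [NeZero N]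

/-- **A list of certified CUSPIDAL `η`-quotients gives a family in `S₂(Γ₀(N))`.**  Entry `(L, t)`: exponent list and
Newman witness (`t² = ∏ δ^{|r_δ|}`); the decidable premise is Newman's four conditions plus Ligozat POSITIVITY at every
cusp (the tree's `etaQuotientCuspForm`). [cite: Ligozat1975, Ch. 3] [cite: Koehler2011, §2.1] -/
theorem exists_etaCuspForms (Ls : List (List (ℕ × ℤ) × ℕ))
    (h : ∀ p ∈ Ls, (∑ δ ∈ N.divisors, expFn p.1 δ = 4) ∧ ((24 : ℤ) ∣ ∑ δ ∈ N.divisors, (δ : ℤ) * expFn p.1 δ) ∧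
      ((24 : ℤ) ∣ ∑ δ ∈ N.divisors, ((N / δ : ℕ) : ℤ) * expFn p.1 δ) ∧
      (p.2 * p.2 = ∏ δ ∈ N.divisors, δ ^ (expFn p.1 δ).natAbs) ∧ (∀ c ∈ N.divisors, 0 < cuspOrder24 N (expFn p.1) c)) :
    ∃ S : Fin Ls.length → CuspForm (Gamma0 N) 2,
      ∀ i, ∀ τ : ℍ, S i τ = etaQuotient N (expFn (Ls[(i : ℕ)]).1) τ := by
  have hN : ∀ i : Fin Ls.length, NewmanCond N (expFn (Ls[(i : ℕ)]).1) 2 := fun i ↦ by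
    obtain ⟨h1, h2, h3, h4, -⟩ := h _ (List.getElem_mem i.isLt)
    exact ⟨by rw [h1]; norm_num, h2, h3, ⟨(Ls[(i : ℕ)]).2, h4.symm⟩⟩
  exact ⟨fun i ↦ etaQuotientCuspForm N (expFn (Ls[(i : ℕ)]).1) 2 (by decide) (hN i)
    (h _ (List.getElem_mem i.isLt)).2.2.2.2, fun i τ ↦ rfl⟩

omit [NeZero N] in
/-- Strict positivity at the cusps implies non-negativity: a certified cuspidal list is a certified holomorphic list
(so parts A–F apply to it unchanged). [folklore] -/
theorem etaHol_of_etaCusp (Ls : List (List (ℕ × ℤ) × ℕ))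
    (h : ∀ p ∈ Ls, (∑ δ ∈ N.divisors, expFn p.1 δ = 4) ∧ ((24 : ℤ) ∣ ∑ δ ∈ N.divisors, (δ : ℤ) * expFn p.1 δ) ∧
      ((24 : ℤ) ∣ ∑ δ ∈ N.divisors, ((N / δ : ℕ) : ℤ) * expFn p.1 δ) ∧
      (p.2 * p.2 = ∏ δ ∈ N.divisors, δ ^ (expFn p.1 δ).natAbs) ∧ (∀ c ∈ N.divisors, 0 < cuspOrder24 N (expFn p.1) c)) :
    ∀ p ∈ Ls, (∑ δ ∈ N.divisors, expFn p.1 δ = 4) ∧ ((24 : ℤ) ∣ ∑ δ ∈ N.divisors, (δ : ℤ) * expFn p.1 δ) ∧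
      ((24 : ℤ) ∣ ∑ δ ∈ N.divisors, ((N / δ : ℕ) : ℤ) * expFn p.1 δ) ∧
      (p.2 * p.2 = ∏ δ ∈ N.divisors, δ ^ (expFn p.1 δ).natAbs) ∧ (∀ c ∈ N.divisors, 0 ≤ cuspOrder24 N (expFn p.1) c) :=
  fun p hp ↦ by
    obtain ⟨h1, h2, h3, h4, h5⟩ := h p hp
    exact ⟨h1, h2, h3, h4, fun c hc ↦ (h5 c hc).le⟩

end CuspBasis

/-! ## §G2 A pinning identity in `S₂(Γ₀(N))` read in `M₂(Γ₀(N))` -/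

section Inclusion

variable {N : ℕ} {k : ℤ}

/-- The `M_k`-image has the same values. [folklore] -/
theorem modularForm_apply (f : CuspForm (Gamma0 N) k) (τ : ℍ) :
    (ModularFormClass.modularForm f : ModularForm (Gamma0 N) k) τ = f τ := rfl

/-- A pinning identity in `S_k` is read in `M_k` through the linear inclusion (Mathlib `CuspForm.toModularFormₗ`). [folklore] -/
theorem smul_modularForm_eq_sum {g : ℕ} (F : CuspForm (Gamma0 N) k) (S : Fin g → CuspForm (Gamma0 N) k)
    (C : Fin g → ModularForm (Gamma0 N) k) (hCS : ∀ i, ModularFormClass.modularForm (S i) = C i)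
    (a : ℂ) (y : Fin g → ℂ) (h : a • F = ∑ j, y j • S j) :
    a • (ModularFormClass.modularForm F : ModularForm (Gamma0 N) k) = ∑ j, y j • C j := by
  have h2 := congrArg (CuspForm.toModularFormₗ (Γ := Gamma0 N) (k := k)) h
  rw [map_smul, map_sum] at h2
  simp only [map_smul, CuspForm.toModularFormₗ_eq_coe, hCS] at h2
  exact h2

end Inclusion

/-! ## §G3 Pinning in `S₂(Γ₀(N))`, read in `M₂(Γ₀(N))` -/

section CuspPinning

variable (N : ℕ) [NeZero N] {W : WeierstrassCurve ℚ} [W.IsElliptic] (D : ModularParametrizationData W N)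
  {g K : ℕ} (S : Fin g → CuspForm (Gamma0 N) 2) (C : Fin g → ModularForm (Gamma0 N) 2)
  (hCS : ∀ i, ModularFormClass.modularForm (S i) = C i) (t u : Fin g → List ℤ) (d : ℤ)
  (ht : ∀ i, ∀ n < K, (((t i).getD n 0 : ℤ) : ℂ) = modCoefₗ N 2 n (C i)) (hu : ∀ i, (u i).length ≤ K)
  (hdual : ∀ i j, dotList (u i) (t j) = if i = j then d else 0) (hd : d ≠ 0)
  (hdim : Module.finrank ℂ (CuspForm (Gamma0 N) 2) = g)

include hCS ht hu hdual hd hdim in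
/-- **PINNING, LIST FORM, IN `S₂(Γ₀(N))` READ IN `M₂(Γ₀(N))`.**  Let `S` be a family of `g = dim S₂(Γ₀(N))` cusp forms
whose `M₂`-images `C` have certified tables `t` to depth `K` with an integer dual system `u` (`⟨uᵢ, tⱼ⟩ = d·δᵢⱼ`,
`d ≠ 0`).  If every stage relation is a certified column relation and every candidate of the staged sieve comes with a
certified coordinate vector, then for the candidate `(σ, d', y)` whose `σ` is the truth of `W`:
`d' • D.f = Σ_j y_j • S_j` in `S₂(Γ₀(N))` AND `d' • D.f = Σ_j y_j • C_j` in `M₂(Γ₀(N))` (pushed through the inclusion; the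
second form is the one the Fricke sieve of part C and the `M₂`-levels' row files consume, the first is what a row file at a
CUSP-pinned level feeds to part F's `eq_of_smul_eq_sum_of_row` in `V = S₂`).
Part B's `exists_smul_eq_sum_of_certs` with `V = S₂(Γ₀(N))`, `coef = cuspCoeffₗ`, `F = D.f`, `hF = D.isNewformOf.2`.
[cite: CremonaAlgorithms1997, §2.10] [cite: DiamondShurman2005, Thm. 3.5.1] -/
theorem exists_smul_eq_sum_of_certs_cusp (stages : List (ℕ × List (List ℤ))) (hps : ∀ st ∈ stages, st.1.Prime)
    (hrel : ∀ st ∈ stages, ∀ v ∈ st.2, v.length ≤ K ∧ ∀ j, dotList v (t j) = 0)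
    (cert : List (List (ℕ × ℤ) × ℤ × List ℤ))
    (hcover : ∀ σ ∈ runSieve N K stages, σ ∈ cert.map Prod.fst)
    (hpiv : ∀ c ∈ cert, ∀ i, ∀ n < (u i).length, (u i).getD n 0 ≠ 0 →
      (evalOpt N c.1 n).map (fun x ↦ c.2.1 * x) = some (∑ j : Fin g, c.2.2.getD (j : ℕ) 0 * (t j).getD n 0)) :
    ∃ c ∈ cert, c.1 = truth W (stages.map Prod.fst) ∧
      ((c.2.1 : ℤ) : ℂ) • D.f = ∑ j : Fin g, ((c.2.2.getD (j : ℕ) 0 : ℤ) : ℂ) • S j ∧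
      ((c.2.1 : ℤ) : ℂ) • (ModularFormClass.modularForm D.f : ModularForm (Gamma0 N) 2) =
        ∑ j : Fin g, ((c.2.2.getD (j : ℕ) 0 : ℤ) : ℂ) • C j := by
  haveI : FiniteDimensional ℂ (CuspForm (Gamma0 N) 2) := finiteDimensional_cuspForm_gamma0 N 2
  have htS : ∀ i, ∀ n < K, (((t i).getD n 0 : ℤ) : ℂ) = cuspCoeffₗ (one_mem_strictPeriods_coe_gamma0 N) n (S i) :=
    fun i n hn ↦ by rw [cuspCoeffₗ_apply, ← modCoefₗ_modularForm (S i) n, hCS]; exact ht i n hn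
  have hF : ∀ n, cuspCoeffₗ (one_mem_strictPeriods_coe_gamma0 N) n D.f = ((W.LFunction n : ℤ) : ℂ) :=
    fun n ↦ by rw [cuspCoeffₗ_apply]; exact D.isNewformOf.2 n
  obtain ⟨c, hc, hc1, hpin⟩ := exists_smul_eq_sum_of_certs D D.f hF S t u d htS hu hdual hd hdim stages hps hrel cert
    hcover hpiv
  exact ⟨c, hc, hc1, hpin, smul_modularForm_eq_sum D.f S C hCS _ (fun j ↦ ((c.2.2.getD (j : ℕ) 0 : ℤ) : ℂ)) hpin⟩

end CuspPinning

end Summit.BirchSwinnertonDyer.BirchSwinnertonDyer.Theorems.ManinLocalTwoThree.PinningKernel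

end
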